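import Literature.AlgebraicGeometry.HodgeTheory.HodgeGenericQbarDescentTwoFacts
import Literature.AlgebraicGeometry.FundamentalGroup.RiemannExistenceSmoothAffine
import HarnessLib

/-!
# Voisin 2007, Prop. 0.7: the `ℚ̄`-descent step from ONE named fact (global invariant cycles)

Topic `Literature/AlgebraicGeometry/HodgeTheory`; theorems only (no definition, no named fact).

`HodgeGenericQbarDescentTwoFacts.lean` reduces the named fact
`voisin2007_algebraic_of_finite_monodromyOrbit_of_qbar` (Voisin, *Hodge loci and absolute Hodge
classes*, Compositio 143 (2007), proof of Prop. 0.7 = arXiv Prop. 1.7: a rational `(p,p)` class with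
finite monodromy orbit on a fibre of a smooth projective family defined over `ℚ̄` is algebraic,
granted the Hodge conjecture for smooth projective varieties defined over `ℚ̄`) to exactly TWO named
facts of the tree: Riemann existence with descent to `ℚ̄`
(`FundamentalGroup.riemannExistence_qbarDescent_of_finiteIndex`, SGA 1 XII Thm. 5.1 + XIII 4.6) and
Deligne's global invariant cycle theorem (`deligne_globalInvariantCycles`, Hodge II, Thm. 4.1.1).
The first is now DISCHARGED (`FundamentalGroup.riemannExistence_qbarDescent_of_finiteIndex_holds`,
`RiemannExistenceSmoothAffine.lean`: Hörmander's `L²` estimates on flat Riemann domains for the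
transcendental half, spreading out for the descent), so the reduction is to ONE fact:

* `voisin2007_algebraic_of_finite_monodromyOrbit_of_qbar_of_globalInvariantCycles (hGICT)`.

`voisin2007_algebraic_of_finite_monodromyOrbit_of_qbar_holds` will be this theorem applied to
`deligne_globalInvariantCycles_holds` once Deligne's theorem is discharged.

## References

* [Voisin2007HodgeLoci] C. Voisin, Hodge loci and absolute Hodge classes, Compositio Math. 143
  (2007), §3, proof of Prop. 0.7 (arXiv math/0605766: Prop. 1.7, p. 7).
* [SGA1] A. Grothendieck, M. Raynaud, SGA 1, Exp. XII Thm. 5.1 (p. 333), Exp. XIII Cor. 4.6.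
* [DeligneHodgeII1971] P. Deligne, Théorie de Hodge II, Publ. Math. IHÉS 40 (1971), Thm. 4.1.1.

#harness_tags algebraic_geometry.hodge_conjecture, algebraic_geometry.sga1
-/

noncomputable section

namespace Literature.AlgebraicGeometry.HodgeTheory

/-- **Voisin 2007, Prop. 0.7 (= arXiv Prop. 1.7) from ONE unproved named fact** —
`voisin2007_algebraic_of_finite_monodromyOrbit_of_qbar_of_twoNamedFacts` with its first hypothesis,
Riemann existence with descent to `ℚ̄` (SGA 1 XII Thm. 5.1 + XIII Cor. 4.6), supplied by the tree's
discharge `FundamentalGroup.riemannExistence_qbarDescent_of_finiteIndex_holds`. What remains is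
Deligne's global invariant cycle theorem (`deligne_globalInvariantCycles`, Hodge II Thm. 4.1.1);
`…_holds` is this theorem applied to its discharge.
[cite: Voisin2007HodgeLoci, §3, proof of Prop. 0.7 (arXiv math/0605766 Prop. 1.7, p. 7)]
[cite: SGA1, Exp. XII Thm. 5.1 (p. 333) and Exp. XIII Cor. 4.6]
[cite: DeligneHodgeII1971, Théorème 4.1.1] -/
theorem voisin2007_algebraic_of_finite_monodromyOrbit_of_qbar_of_globalInvariantCycles
    (hGICT : deligne_globalInvariantCycles) :
    voisin2007_algebraic_of_finite_monodromyOrbit_of_qbar :=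
  voisin2007_algebraic_of_finite_monodromyOrbit_of_qbar_of_twoNamedFacts
    FundamentalGroup.riemannExistence_qbarDescent_of_finiteIndex_holds hGICT

end Literature.AlgebraicGeometry.HodgeTheory

end
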